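import Mathlib
import Literature.MathematicalPhysics.QuantumFieldTheory.Balaban1983to89.B6TransplantMajorants
import Literature.MathematicalPhysics.QuantumFieldTheory.Balaban1983to89.B6DomainMajorant

/-!
# `Balaban1983to89.B6TorusFarCorrection` — T. Bałaban, *Propagators and renormalization transformations for lattice gauge theories. II*,
Commun. Math. Phys. **96** (1984) 223–250 [Balaban1984PropagatorsII]: **the honest `X̃_□ = Q′G′(□̃)²Q′*` of the modified prescription (2.70)
against the cut operator of the line-3 chain** — the transplant algebra `Q′G′(□̃)²Q′*(y, y″) = (Q′G′_{T_□̃}²Q′*)(ι_Ky, ι_Ky″)` up to the paths of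
`G′_{T_□̃}` through the FAR REGION of the window (outside the core `V`), and the bound of that far term by *"the usual factors"* times
`e^{−(2δ/3)·dist(core, far region)}` — the (1.12)-type factor of p. 238.

statement-level skeleton of published theorems with citation tags; proofs where landed; nothing here is a claim about the Yang–Mills mass gap

Phase-2 PROOF SEAT p01 (gen 8) of the cell `lit-balaban` (HOME `run/shared/lean/pub/lit-balaban/`), free-target protocol G.5-34(d), own lane;
file 6 of the programme «the MODIFIED prescription of (2.70) `C_□ = ((Q′G′(□̃)²Q′*)↾□)⁻¹` with `G′(□̃)` on the torus `T_□̃` and the p. 238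
change-of-domain sentence, genuine».  Sources read as page images: `run/shared/lean/pub/pub-balaban/b2b-balaban-ref1/pages/
1984-cmp96-propagators-rt-II/1984-cmp96-propagators-rt-II-p013-x2.png` (p. 235), `…-p016-x2.png` (p. 238); journal page = PDF page + 222.

THE PRINTED TEXT.  p. 235: *"we take an inverse of the operator (Q′G′(□̃)²Q′*)↾□"*; p. 238: *"the operator with G′(□̃)² − G′² is small and
an estimate has the factor exp(−δ₀M) because of the usual estimate of the type (1.12) [3] connected with a change of a domain. This estimate
follows from the random walk representations (2.50) for the operators G′, G′(□̃)."*

WHY THIS FILE.  The line-3 chain of the cell (`B6Prop23DomainInput.hdom_of_line3`) compares `Q′G′²Q′*` with `Q′G_w²Q′*` for an operator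
`G_w` ON THE BIG LATTICE carrying a 𝔅-majorant; the Green's function of the torus `T_□̃` pulled back to the whole window has no such majorant
in the big-torus distance (the small torus wraps sooner), so the chain is fed the CUT operator `G_w = 1_V·J·G′_{T_□̃}·Jᵀ·1_V`
(`B6TorusTransplant.GwMat`).  The honest (2.70)-object is `X̃_□(y, y″) = (Q′_{T_□̃}G′_{T_□̃}²Q′*_{T_□̃})(ι_Ky, ι_Ky″)`; this file proves
`X̃_□ − Q′G_w²Q′* = (Q′G′_{T_□̃}·1_far·G′_{T_□̃}Q′*)∘ι_K` on `V × V` and bounds the right side.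

WHAT THIS FILE PROVES (kernel-checked, 0 sorry, axioms standard).  `P′ = smallVol P m′`, window corner `c`, core `V` (deep blocks):
* §1 entries of `Q′_K`, `Q′_K*` (`Qk_apply`, `Qks_apply`), `(Q′MQ′*)(y, y′)` as a block average (`Qk_mul_mul_Qks_apply`) and **the entry bound
  from a 𝔅-majorant**: `HasMajorant blk M K ⟹ |(Q′MQ′*)(y, y′)| ≤ K(y, y′)` (`abs_Qk_mul_mul_Qks_le`); the summation profile of `|·|₁`
  (`profile_T1`).
* §2 **THE TRANSPLANT ALGEBRA**: with `nearMat = Q′G′·diag(1_V∘κ₀)·G′Q′*` and `farMat = Q′G′·diag(1 − 1_V∘κ₀)·G′Q′*` on the small torus,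
  `Q′G′_{T_□̃}²Q′* = nearMat + farMat` (`qggqK_eq_near_add_far`) and, for `y, y″ ∈ V`,
  **`(Q′_K·G_w·G_w·Q′_K*)(y, y″) = nearMat(ι_Ky, ι_Ky″)`** (`Xw_entry_eq`) — hence
  `X̃_□(y,y″) − (Q′G_w²Q′*)(y,y″) = farMat(ι_Ky, ι_Ky″)` (`qggqK_iotaK_sub_Xw_entry`).
* §3 **THE FAR BOUND**: if `G′_{T_□̃}` has the 𝔅′-majorant `C·e^{−δ|z−z′|′₁}` then, for core blocks `y, y″` at `|·|′₁`-distance `≥ D₀` from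
  every far block, `|farMat(ι_Ky, ι_Ky″)| ≤ C²·c₀(δ/3,1)^d·e^{−(δ/3)·2D₀}·e^{−(δ/3)|ι_Ky − ι_Ky″|′₁}` (`abs_farMat_le`; the far zone `farZone`, its
  depth `B6DomainMajorant.zoneDepth`, the zone convolution `B6DomainMajorant.shape_conv_zone`, evaluation `B6DomainChange.Shape.apply_le`) and
  the packaged difference bound `abs_qggqK_iotaK_sub_Xw_le`.

HONEST SCOPE ∕ NOT CLAIMED.  Rates: the certificate's `δ/3` (each leg of the zone convolution keeps a third), not the printed `δ₀`; the depth
`D₀` is a hypothesis here (the sibling (2.70) file computes it from the cube geometry, `D₀ ≍ L^{m′}`, which is `≥ M`).  One scale, scalar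
model, periodic `G′(□̃)`.  Value = the located algebra + estimate making the (2.70) object honest, NOT summit progress.
-/

namespace Literature.MathematicalPhysics.QuantumFieldTheory.Balaban1983to89.B6TorusFarCorrection

open Finset Matrix
open B4Sect5Torus (IsPseudoDist)
open B1RG242Torus (tower Qk Qks lvl lvl_of_le)
open B5Ineq137Torus (blk fine)
open B6Prop22OneScaleTorus (T1 oneScaleGeo blk_fine)
open B6Lemma21TowerTorus (T1_triangle T1_symm T1_nonneg sum_exp_T1_le)
open B6QGGQInvTowerTorus (wQ wQ_pos qggqK T1_isPseudoDist T1_self G_transpose)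
open B6RandomWalk (HasMajorant BlockSupp hasMajorant_mul hasMajorant_mono)
open B6DomainChange (Profile Shape IsDepth)
open B6DomainMajorant (hasMajorant_mulOp_zone expK zoneK expK_apply zoneK_apply expK_nonneg zoneK_nonneg shape_conv_zone zoneDepth
  le_zoneDepth isDepth_zoneDepth zoneDepth_eq_zero)
open B6TorusWindowChart B6TorusTransplant B6TransplantMajorants
open B6Commutator244TowerTorus (Gop Gop_apply_eq wQ_mul_card_block)

noncomputable section

variable {P : Params}

/-! ## §1  Entries of `Q′`, `Q′*`; the entry bound from a 𝔅-majorant; the profile of `|·|₁` -/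

/-- `Q′_j(y, x) = L^{−jd}·[x ∈ B^j(y)]` (`j ≤ m + K`). [cite: Balaban1984PropagatorsII, (2.1) p.224; bookkeeping] -/
theorem Qk_apply {j : ℕ} (hj : j ≤ P.m + P.K) (y : Site P j) (x : Site P 0) :
    Qk P j y x = if blk P j x = y then wQ P j else 0 := by
  show (if Site.proj j (lvl P j) x = y then wQ P j else 0) = _
  rw [lvl_of_le P hj]
  rfl

/-- `Q′_j*(x, y) = [x ∈ B^j(y)]` (`j ≤ m + K`). [cite: Balaban1984PropagatorsII, (2.1) p.224; bookkeeping] -/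
theorem Qks_apply {j : ℕ} (hj : j ≤ P.m + P.K) (x : Site P 0) (y : Site P j) :
    Qks P j x y = if blk P j x = y then 1 else 0 := by
  show (if Site.proj j (lvl P j) x = y then (1 : ℝ) else 0) = _
  rw [lvl_of_le P hj]
  rfl

/-- `(Q′_jh)(y) = L^{−jd}Σ_{x∈B^j(y)}h(x)`. [cite: Balaban1984PropagatorsII, (2.1) p.224; bookkeeping] -/
theorem Qk_mulVec_eq {j : ℕ} (hj : j ≤ P.m + P.K) (h : Site P 0 → ℝ) (y : Site P j) :
    (Qk P j *ᵥ h) y = wQ P j * ∑ x ∈ univ.filter (fun x => blk P j x = y), h x := by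
  rw [Finset.sum_filter, Finset.mul_sum]
  simp only [Matrix.mulVec, dotProduct, Qk_apply hj]
  refine Finset.sum_congr rfl fun x _ => ?_
  split_ifs <;> simp

/-- the entry `(A·Q′*)(i, y′)` is `A` applied to the block indicator column of `y′`. [cite: Balaban1984PropagatorsII, (2.1) p.224; bookkeeping] -/
theorem mul_Qks_apply {m : Type*} {j : ℕ} (A : Matrix m (Site P 0) ℝ) (i : m) (y' : Site P j) :
    (A * Qks P j) i y' = (A *ᵥ fun x' => Qks P j x' y') i := rfl

/-- `(Q′MQ′*)(y, y′) = L^{−jd}Σ_{x∈B(y)}(M·1_{B(y′)})(x)`. [cite: Balaban1984PropagatorsII, (2.69) p.235; bookkeeping] -/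
theorem Qk_mul_mul_Qks_apply {j : ℕ} (hj : j ≤ P.m + P.K) (M : Matrix (Site P 0) (Site P 0) ℝ) (y y' : Site P j) :
    (Qk P j * M * Qks P j) y y' =
      wQ P j * ∑ x ∈ univ.filter (fun x => blk P j x = y), (M *ᵥ fun x' => Qks P j x' y') x := by
  rw [mul_Qks_apply, ← Matrix.mulVec_mulVec, Qk_mulVec_eq hj]

/-- `L^{−Kd}·|B^K(y)| = 1` at a unit site. [cite: Balaban1982Higgs1, (2.11) p.609; bookkeeping] -/
theorem wQ_mul_card_blk (y : Site P P.K) :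
    wQ P P.K * ((univ.filter fun x : Site P 0 => blk P P.K x = y).card : ℝ) = 1 := by
  have h := wQ_mul_card_block (P := P) (fine P P.K y)
  rwa [blk_fine P (Nat.le_add_left _ _) y] at h

/-- **the entry bound from a 𝔅-majorant**: if `M` (on `L²(T_η)`) has the 𝔅-majorant `K`, then `|(Q′_KMQ′_K*)(y, y′)| ≤ K(y, y′)` —
`Q′*δ_{y′}` is the indicator of the block `y′` (bound 1) and `Q′` averages over the block `y`.
[cite: Balaban1984PropagatorsII, (2.51) p.232, (2.69) p.235] -/
theorem abs_Qk_mul_mul_Qks_le {Mb R : ℕ} {M : Matrix (Site P 0) (Site P 0) ℝ} {K : Site P P.K → Site P P.K → ℝ}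
    (hM : HasMajorant (g := oneScaleGeo P Mb R) (blk P P.K) (Matrix.toLin' M) K) (y y' : Site P P.K) :
    |(Qk P P.K * M * Qks P P.K) y y'| ≤ K y y' := by
  have hK : P.K ≤ P.m + P.K := Nat.le_add_left _ _
  rw [Qk_mul_mul_Qks_apply hK]
  have hf : BlockSupp (g := oneScaleGeo P Mb R) (blk P P.K) (fun x' => Qks P P.K x' y') y' 1 :=
    ⟨zero_le_one, fun x hx => by simp only [Qks_apply hK, if_pos hx, abs_one, le_refl],
      fun x hx => by simp only [Qks_apply hK, if_neg hx]⟩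
  have hb : ∀ x ∈ univ.filter (fun x => blk P P.K x = y), |(M *ᵥ fun x' => Qks P P.K x' y') x| ≤ K y y' := by
    intro x hx
    have h := hM y' _ 1 hf x
    rw [Matrix.toLin'_apply, (Finset.mem_filter.mp hx).2, mul_one] at h
    exact h
  have hw := wQ_pos P P.K
  calc |wQ P P.K * ∑ x ∈ univ.filter (fun x => blk P P.K x = y), (M *ᵥ fun x' => Qks P P.K x' y') x|
      = wQ P P.K * |∑ x ∈ univ.filter (fun x => blk P P.K x = y), (M *ᵥ fun x' => Qks P P.K x' y') x| := by
        rw [abs_mul, abs_of_pos hw]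
    _ ≤ wQ P P.K * ∑ x ∈ univ.filter (fun x => blk P P.K x = y), |(M *ᵥ fun x' => Qks P P.K x' y') x| :=
        mul_le_mul_of_nonneg_left (Finset.abs_sum_le_sum_abs _ _) hw.le
    _ ≤ wQ P P.K * ∑ x ∈ univ.filter (fun x => blk P P.K x = y), K y y' :=
        mul_le_mul_of_nonneg_left (Finset.sum_le_sum hb) hw.le
    _ = K y y' := by
        rw [Finset.sum_const, nsmul_eq_mul, ← mul_assoc, wQ_mul_card_blk, one_mul]

/-- **the summation profile of the unit distance**: `Σ_{y′} e^{−t|y − y′|₁} ≤ c₀(t, 1)^d` for every `t > 0` (Lemma 2.1's (2.61) on one scale,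
repaired constant). [cite: Balaban1984PropagatorsII, (2.61) p.234] -/
theorem profile_T1 (P : Params) (j : ℕ) : Profile (T1 P j) (fun a : Site P j => a) (fun t => B6.c0 t 1 ^ P.d) := by
  intro t ht y
  have h := sum_exp_T1_le P j (show 0 < (1 : ℝ) * t by simpa using ht) y
  simpa only [one_mul] using h

/-! ## §2  The transplant algebra: `X̃_□` against `Q′G_w²Q′*` -/

section Algebra

variable {c : Site P P.K} {m' : ℕ} {V : Finset (Site P P.K)} {a msq : ℝ}

variable (P) in
/-- the NEAR part of `Q′G′_{T_□̃}²Q′*`: the paths of the middle point over the core, `Q′G′·diag(1_V∘κ₀)·G′Q′*` on `T_□̃`.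
[cite: Balaban1984PropagatorsII, p.238; bookkeeping] -/
def nearMat (c : Site P P.K) (m' : ℕ) (V : Finset (Site P P.K)) (a msq : ℝ) :
    Matrix (Site (smallVol P m') P.K) (Site (smallVol P m') P.K) ℝ :=
  Qk (smallVol P m') P.K * (tower (smallVol P m') a msq).G (smallVol P m').K *
    Matrix.diagonal (indV P V ∘ kap0 P c m') * (tower (smallVol P m') a msq).G (smallVol P m').K * Qks (smallVol P m') P.K

variable (P) in
/-- the indicator of the FAR REGION of `T_□̃`: the fine sites whose window block is not in the core `V`.
[cite: Balaban1984PropagatorsII, p.238 («a change of a domain»); bookkeeping] -/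
def farInd (c : Site P P.K) (m' : ℕ) (V : Finset (Site P P.K)) (z : Site (smallVol P m') 0) : ℝ :=
  1 - indV P V (kap0 P c m' z)

variable (P) in
/-- the FAR part: the paths of the middle point through the far region, `Q′G′·diag(1 − 1_V∘κ₀)·G′Q′*` on `T_□̃`.
[cite: Balaban1984PropagatorsII, p.238; bookkeeping] -/
def farMat (c : Site P P.K) (m' : ℕ) (V : Finset (Site P P.K)) (a msq : ℝ) :
    Matrix (Site (smallVol P m') P.K) (Site (smallVol P m') P.K) ℝ :=
  Qk (smallVol P m') P.K * (tower (smallVol P m') a msq).G (smallVol P m').K *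
    Matrix.diagonal (farInd P c m' V) * (tower (smallVol P m') a msq).G (smallVol P m').K * Qks (smallVol P m') P.K

/-- `farInd ∈ {0, 1}`: it is `0` over core blocks and `1` elsewhere. [cite: Balaban1984PropagatorsII, p.238; bookkeeping] -/
theorem farInd_eq (z : Site (smallVol P m') 0) :
    farInd P c m' V z = if blk P P.K (kap0 P c m' z) ∈ V then 0 else 1 := by
  unfold farInd indV
  split_ifs <;> norm_num

/-- **`Q′G′_{T_□̃}²Q′* = nearMat + farMat`** (insert `1 = 1_V∘κ₀ + (1 − 1_V∘κ₀)` between the two Green's functions).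
[cite: Balaban1984PropagatorsII, (2.68) p.235, p.238] -/
theorem qggqK_eq_near_add_far : qggqK (smallVol P m') a msq = nearMat P c m' V a msq + farMat P c m' V a msq := by
  unfold nearMat farMat
  rw [← Matrix.add_mul, ← Matrix.add_mul, ← Matrix.mul_add, Matrix.diagonal_add]
  have h1 : (fun z => (indV P V ∘ kap0 P c m') z + farInd P c m' V z) = fun _ => 1 := by
    funext z
    simp only [Function.comp, farInd, add_sub_cancel]
  rw [h1, Matrix.diagonal_one, Matrix.mul_one]
  rfl

/-- the block indicator of `y″ ∈ V`, cut to `V` and pulled back, is the block indicator of `ι_Ky″`.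
[cite: Balaban1984PropagatorsII, (2.1) p.224; bookkeeping] -/
theorem Jt_indV_blockInd (hm : m' ≤ P.m) (hV : ∀ y ∈ V, DeepBlk P c m' y) {y'' : Site P P.K} (hy'' : y'' ∈ V) :
    (Jmat P c m')ᵀ *ᵥ (Matrix.diagonal (indV P V) *ᵥ fun x' => Qks P P.K x' y'') =
      fun z => Qks (smallVol P m') P.K z (iotaK P c m' y'') := by
  have hK : P.K ≤ P.m + P.K := Nat.le_add_left _ _
  have hK' : P.K ≤ (smallVol P m').m + (smallVol P m').K := Nat.le_add_left _ _
  funext z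
  rw [Jt_indV_mulVec, Qks_apply hK, Qks_apply hK']
  have hz : blk (smallVol P m') P.K z = iotaK P c m' (blk P P.K (kap0 P c m' z)) := by
    rw [← blk_iota0 (inW0_kap0 (c := c) hm z), iota0_kap0 hm]
  by_cases h : blk P P.K (kap0 P c m' z) = y''
  · rw [if_pos h, indV_of_mem (h ▸ hy''), one_mul, if_pos (by rw [hz, h])]
  · rw [if_neg h, mul_zero, if_neg]
    intro h'
    rw [hz] at h'
    exact h (iotaK_injOn ((inW0_iff_inW _).mp (inW0_kap0 hm z)) (inW_of_deepBlk (hV _ hy'')) h')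

/-- pulling back a cut transplanted function: `Jᵀ(1_V·(x ↦ 1_V(x)g(ι₀x))) = diag(1_V∘κ₀)g`. [cite: Balaban1984PropagatorsII, p.238; bookkeeping] -/
theorem Jt_indV_transplanted (hm : m' ≤ P.m) (g : Site (smallVol P m') 0 → ℝ) :
    (Jmat P c m')ᵀ *ᵥ (Matrix.diagonal (indV P V) *ᵥ fun x => indV P V x * g (iota0 P c m' x)) =
      Matrix.diagonal (indV P V ∘ kap0 P c m') *ᵥ g := by
  funext z
  rw [Jt_indV_mulVec, Matrix.mulVec_diagonal, Function.comp_apply, iota0_kap0 hm, ← mul_assoc]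
  congr 1
  unfold indV
  split_ifs <;> norm_num

/-- **THE TRANSPLANT ALGEBRA**: for core blocks `y, y″ ∈ V`, `(Q′_K·G_w·G_w·Q′_K*)(y, y″) = nearMat(ι_Ky, ι_Ky″)` — the cut operator of the
line-3 chain, read through `Q′…Q′*` on the core, IS the near part of `Q′G′_{T_□̃}²Q′*` transplanted.
[cite: Balaban1984PropagatorsII, p.235 («(Q′G′(□̃)²Q′*)↾□»), p.238] -/
theorem Xw_entry_eq (hm : m' ≤ P.m) (hV : ∀ y ∈ V, DeepBlk P c m' y) {y y'' : Site P P.K} (hy : y ∈ V) (hy'' : y'' ∈ V) :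
    (Qk P P.K * GwMat P c m' V a msq * GwMat P c m' V a msq * Qks P P.K) y y'' =
      nearMat P c m' V a msq (iotaK P c m' y) (iotaK P c m' y'') := by
  have hK : P.K ≤ P.m + P.K := Nat.le_add_left _ _
  have hK' : P.K ≤ (smallVol P m').m + (smallVol P m').K := Nat.le_add_left _ _
  -- left side, innermost to outermost
  have h1 : GwMat P c m' V a msq *ᵥ (fun x' => Qks P P.K x' y'') =
      fun x => indV P V x * ((tower (smallVol P m') a msq).G (smallVol P m').K *ᵥ
        fun z => Qks (smallVol P m') P.K z (iotaK P c m' y'')) (iota0 P c m' x) := by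
    funext x
    rw [GwMat_mulVec hm hV, Jt_indV_blockInd hm hV hy'']
  have h2 : ∀ g : Site (smallVol P m') 0 → ℝ,
      GwMat P c m' V a msq *ᵥ (fun x => indV P V x * g (iota0 P c m' x)) =
        fun x => indV P V x * ((tower (smallVol P m') a msq).G (smallVol P m').K *ᵥ
          (Matrix.diagonal (indV P V ∘ kap0 P c m') *ᵥ g)) (iota0 P c m' x) := by
    intro g
    funext x
    rw [GwMat_mulVec hm hV, Jt_indV_transplanted hm]
  rw [mul_Qks_apply, ← Matrix.mulVec_mulVec, ← Matrix.mulVec_mulVec, h1, h2, Qk_mulVec_eq hK]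
  -- right side
  unfold nearMat
  rw [mul_Qks_apply, ← Matrix.mulVec_mulVec, ← Matrix.mulVec_mulVec, ← Matrix.mulVec_mulVec, Qk_mulVec_eq hK',
    wQ_smallVol', ← sum_block_transplant_unit hm (inW_of_deepBlk (hV _ hy))]
  congr 1
  refine Finset.sum_congr rfl fun x hx => ?_
  rw [indV_of_mem (((Finset.mem_filter.mp hx).2).symm ▸ hy), one_mul]

/-- **the honest (2.70)-object minus the cut one is the far part**: for `y, y″ ∈ V`,
`(Q′G′_{T_□̃}²Q′*)(ι_Ky, ι_Ky″) − (Q′_KG_w²Q′_K*)(y, y″) = farMat(ι_Ky, ι_Ky″)`. [cite: Balaban1984PropagatorsII, p.235, p.238] -/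
theorem qggqK_iotaK_sub_Xw_entry (hm : m' ≤ P.m) (hV : ∀ y ∈ V, DeepBlk P c m' y) {y y'' : Site P P.K} (hy : y ∈ V)
    (hy'' : y'' ∈ V) :
    qggqK (smallVol P m') a msq (iotaK P c m' y) (iotaK P c m' y'') -
        (Qk P P.K * GwMat P c m' V a msq * GwMat P c m' V a msq * Qks P P.K) y y'' =
      farMat P c m' V a msq (iotaK P c m' y) (iotaK P c m' y'') := by
  rw [Xw_entry_eq hm hV hy hy'', qggqK_eq_near_add_far (c := c) (V := V), Matrix.add_apply, add_sub_cancel_left]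

end Algebra

/-! ## §3  The far bound -/

section FarBound

variable {c : Site P P.K} {m' : ℕ} {V : Finset (Site P P.K)} {a msq : ℝ}

variable (P) in
/-- **the far zone** of `T′₁^{(K)}`: the unit blocks of `T_□̃` coming from window blocks outside the core `V`.
[cite: Balaban1984PropagatorsII, p.238 («a change of a domain»); bookkeeping] -/
def farZone (c : Site P P.K) (m' : ℕ) (V : Finset (Site P P.K)) : Finset (Site (smallVol P m') P.K) :=
  (univ.filter fun y : Site P P.K => InW P c m' y ∧ y ∉ V).image (iotaK P c m')

/-- the far indicator lives over the far zone. [cite: Balaban1984PropagatorsII, p.238; bookkeeping] -/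
theorem farInd_eq_zero_of_not_mem (hm : m' ≤ P.m) {z : Site (smallVol P m') 0} (hz : blk (smallVol P m') P.K z ∉ farZone P c m' V) :
    farInd P c m' V z = 0 := by
  rw [farInd_eq]
  split_ifs with h
  · rfl
  · exfalso
    refine hz (Finset.mem_image.mpr ⟨blk P P.K (kap0 P c m' z), Finset.mem_filter.mpr ⟨Finset.mem_univ _,
      (inW0_iff_inW _).mp (inW0_kap0 hm z), h⟩, ?_⟩)
    rw [← blk_iota0 (inW0_kap0 (c := c) hm z), iota0_kap0 hm]

/-- `|farInd| ≤ 1`. [cite: Balaban1984PropagatorsII, p.238; bookkeeping] -/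
theorem abs_farInd_le_one (z : Site (smallVol P m') 0) : |farInd P c m' V z| ≤ 1 := by
  rw [farInd_eq]; split_ifs <;> simp

/-- a diagonal matrix acts as the multiplication operator of the cell's majorant toolkit. [folklore] -/
private theorem toLin'_diagonal (h : Site (smallVol P m') 0 → ℝ) :
    Matrix.toLin' (Matrix.diagonal h) = (B9Thm37Sum.mulOp h : Module.End ℝ (Site (smallVol P m') 0 → ℝ)) := by
  refine LinearMap.ext fun f => ?_
  rw [Matrix.toLin'_apply]
  funext x
  rw [Matrix.mulVec_diagonal, B9Thm37Sum.mulOp_apply]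

/-- **the middle operator `G′·1_far·G′` has the zone-convolution majorant** `Σ_u Ce^{−δ|y−u|′₁}·1_far(u)·Ce^{−δ|u−y′|′₁}`.
[cite: Balaban1984PropagatorsII, (2.50)–(2.55) p.232, p.238 («follows from the random walk representations (2.50) for … G′(□̃)»)] -/
theorem hasMajorant_far (hm : m' ≤ P.m) {Mb' R' : ℕ} {C δ : ℝ} (hC : 0 ≤ C)
    (hG' : HasMajorant (g := oneScaleGeo (smallVol P m') Mb' R') (blk (smallVol P m') P.K) (Gop (smallVol P m') a msq)
      (fun z z' => C * Real.exp (-(δ * T1 (smallVol P m') P.K z z')))) :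
    HasMajorant (g := oneScaleGeo (smallVol P m') Mb' R') (blk (smallVol P m') P.K)
      (Matrix.toLin' ((tower (smallVol P m') a msq).G (smallVol P m').K * Matrix.diagonal (farInd P c m' V) *
        (tower (smallVol P m') a msq).G (smallVol P m').K))
      (fun z z' => (expK (oneScaleGeo (smallVol P m') Mb' R') C δ *
        zoneK (oneScaleGeo (smallVol P m') Mb' R') (farZone P c m' V) C δ) z z') := by
  have hzone := hasMajorant_mulOp_zone (g := oneScaleGeo (smallVol P m') Mb' R') (blk (smallVol P m') P.K) hG'
    (farInd P c m' V) abs_farInd_le_one (farZone P c m' V) (fun z hz => farInd_eq_zero_of_not_mem hm hz)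
  have hprod := hasMajorant_mul (g := oneScaleGeo (smallVol P m') Mb' R') (blk (smallVol P m') P.K) hG' hzone
    (fun u b => by positivity)
  have hop : Matrix.toLin' ((tower (smallVol P m') a msq).G (smallVol P m').K * Matrix.diagonal (farInd P c m' V) *
      (tower (smallVol P m') a msq).G (smallVol P m').K) =
      Gop (smallVol P m') a msq * (B9Thm37Sum.mulOp (farInd P c m' V) * Gop (smallVol P m') a msq) := by
    rw [Matrix.mul_assoc, Matrix.toLin'_mul, Matrix.toLin'_mul, toLin'_diagonal]
    rfl
  rw [hop]
  refine hasMajorant_mono (g := oneScaleGeo (smallVol P m') Mb' R') (blk (smallVol P m') P.K) hprod fun z z' => le_of_eq ?_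
  rw [Matrix.mul_apply]
  refine Finset.sum_congr rfl fun u _ => ?_
  rw [expK_apply, zoneK_apply]
  show C * Real.exp (-(δ * T1 (smallVol P m') P.K z u)) *
      ((if u ∈ farZone P c m' V then (1 : ℝ) else 0) * (C * Real.exp (-(δ * T1 (smallVol P m') P.K u z')))) =
    C * Real.exp (-(δ * T1 (smallVol P m') P.K z u)) *
      ((if u ∈ farZone P c m' V then C else 0) * Real.exp (-(δ * T1 (smallVol P m') P.K u z')))
  split_ifs <;> ring

/-- **THE FAR BOUND**: for core blocks `y, y″ ∈ V` at `|·|′₁`-distance `≥ D₀` from every far block,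
`|farMat(ι_Ky, ι_Ky″)| ≤ C²c₀(δ/3,1)^d·e^{−(δ/3)(D₀ + D₀)}·e^{−(δ/3)|ι_Ky − ι_Ky″|′₁}` — *"an estimate has the factor exp(−δ₀M) because of
the usual estimate of the type (1.12) [3] connected with a change of a domain"*, at the certificate's rate.
[cite: Balaban1984PropagatorsII, p.238 before (2.85)] -/
theorem abs_farMat_le (hm : m' ≤ P.m) {Mb' R' : ℕ} {C δ : ℝ} (hC : 0 ≤ C) (hδ : 0 < δ)
    (hG' : HasMajorant (g := oneScaleGeo (smallVol P m') Mb' R') (blk (smallVol P m') P.K) (Gop (smallVol P m') a msq)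
      (fun z z' => C * Real.exp (-(δ * T1 (smallVol P m') P.K z z'))))
    (y y'' : Site P P.K) {D₀ : ℝ}
    (hD : ∀ u ∈ farZone P c m' V, D₀ ≤ T1 (smallVol P m') P.K (iotaK P c m' y) u ∧ D₀ ≤ T1 (smallVol P m') P.K (iotaK P c m' y'') u) :
    |farMat P c m' V a msq (iotaK P c m' y) (iotaK P c m' y'')| ≤
      C * C * (B6.c0 (δ / 3) 1 ^ P.d) * Real.exp (-(δ / 3 * (D₀ + D₀))) *
        Real.exp (-(δ / 3 * T1 (smallVol P m') P.K (iotaK P c m' y) (iotaK P c m' y''))) := by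
  have hent : |farMat P c m' V a msq (iotaK P c m' y) (iotaK P c m' y'')| ≤
      (expK (oneScaleGeo (smallVol P m') Mb' R') C δ * zoneK (oneScaleGeo (smallVol P m') Mb' R') (farZone P c m' V) C δ)
        (iotaK P c m' y) (iotaK P c m' y'') := by
    have h := abs_Qk_mul_mul_Qks_le (P := smallVol P m') (hasMajorant_far (V := V) (c := c) hm hC hG') (iotaK P c m' y)
      (iotaK P c m' y'')
    unfold farMat
    simp only [Matrix.mul_assoc] at h ⊢
    exact h
  by_cases hne : (farZone P c m' V).Nonempty
  · have hρ : IsPseudoDist (oneScaleGeo (smallVol P m') Mb' R').dist := T1_isPseudoDist (smallVol P m') P.K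
    have hβ := isDepth_zoneDepth hρ (farZone P c m' V) hne
    have hPr : Profile (oneScaleGeo (smallVol P m') Mb' R').dist (fun u : (oneScaleGeo (smallVol P m') Mb' R').Site => u)
        (fun t => B6.c0 t 1 ^ (smallVol P m').d) := profile_T1 (smallVol P m') P.K
    have hS := shape_conv_zone hρ hβ hPr (farZone P c m' V) (fun u hu => zoneDepth_eq_zero hρ hne hu) hδ hC hC
    have hi : D₀ ≤ zoneDepth (oneScaleGeo (smallVol P m') Mb' R').dist (farZone P c m' V) hne (iotaK P c m' y) :=
      le_zoneDepth _ hne fun u hu => (hD u hu).1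
    have hj : D₀ ≤ zoneDepth (oneScaleGeo (smallVol P m') Mb' R').dist (farZone P c m' V) hne (iotaK P c m' y'') :=
      le_zoneDepth _ hne fun u hu => (hD u hu).2
    have hK3 : 0 ≤ C * C * (B6.c0 (δ / 3) 1 ^ (smallVol P m').d) := by
      have := B6RandomWalk.c0_nonneg (δ / 3) 1
      positivity
    have hev := Shape.apply_le hS hK3 (by positivity) hi hj
    refine hent.trans (le_trans (le_abs_self _) (hev.trans (le_of_eq ?_)))
    rfl
  · -- empty far zone: the far indicator vanishes, and so does the far part
    have h0 : farInd P c m' V = fun _ => 0 := by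
      funext z
      exact farInd_eq_zero_of_not_mem hm (fun hz => hne ⟨_, hz⟩)
    have hfar0 : farMat P c m' V a msq = 0 := by
      unfold farMat
      rw [h0]
      simp
    rw [hfar0, Matrix.zero_apply, abs_zero]
    have := B6RandomWalk.c0_nonneg (δ / 3) 1
    positivity

/-- **the packaged change-of-domain bound for the honest (2.70)-object**: for `y, y″ ∈ V` at depth `≥ D₀` from the far zone,
`|(Q′G′_{T_□̃}²Q′*)(ι_Ky, ι_Ky″) − (Q′_KG_w²Q′_K*)(y, y″)| ≤ C²c₀(δ/3,1)^d·e^{−(2δ/3)D₀}·e^{−(δ/3)|ι_Ky − ι_Ky″|′₁}`.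
[cite: Balaban1984PropagatorsII, p.238 before (2.85)] -/
theorem abs_qggqK_iotaK_sub_Xw_le (hm : m' ≤ P.m) (hV : ∀ y ∈ V, DeepBlk P c m' y) {Mb' R' : ℕ} {C δ : ℝ} (hC : 0 ≤ C)
    (hδ : 0 < δ)
    (hG' : HasMajorant (g := oneScaleGeo (smallVol P m') Mb' R') (blk (smallVol P m') P.K) (Gop (smallVol P m') a msq)
      (fun z z' => C * Real.exp (-(δ * T1 (smallVol P m') P.K z z'))))
    {y y'' : Site P P.K} (hy : y ∈ V) (hy'' : y'' ∈ V) {D₀ : ℝ}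
    (hD : ∀ u ∈ farZone P c m' V, D₀ ≤ T1 (smallVol P m') P.K (iotaK P c m' y) u ∧ D₀ ≤ T1 (smallVol P m') P.K (iotaK P c m' y'') u) :
    |qggqK (smallVol P m') a msq (iotaK P c m' y) (iotaK P c m' y'') -
        (Qk P P.K * GwMat P c m' V a msq * GwMat P c m' V a msq * Qks P P.K) y y''| ≤
      C * C * (B6.c0 (δ / 3) 1 ^ P.d) * Real.exp (-(2 * (δ / 3) * D₀)) *
        Real.exp (-(δ / 3 * T1 (smallVol P m') P.K (iotaK P c m' y) (iotaK P c m' y''))) := by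
  rw [qggqK_iotaK_sub_Xw_entry hm hV hy hy'', show 2 * (δ / 3) * D₀ = δ / 3 * (D₀ + D₀) by ring]
  exact abs_farMat_le hm hC hδ hG' y y'' hD

end FarBound

end

end Literature.MathematicalPhysics.QuantumFieldTheory.Balaban1983to89.B6TorusFarCorrection
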